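import Summits.CriticalPhenomena.SAWScalingLimit.Theorems.SAWDevelopingMapObservableToSLETypeLadderRotationGates
import Summits.CriticalPhenomena.SAWScalingLimit.Theorems.SAWDevelopingMapObservableToSLETypeLadderRotationSLE
import HarnessLib

/-!
# Co-oriented reduction, part A: one-mesh transports (line `six-class-type-ladder`, crux
`SAWDevelopingMap.ObservableToSLE`, stmt-CriticalPhenomena-10472; lead a2)

Support lemmas for the registered stub `stub_coOrientedReduction` (skeleton r1 of
`Cruxes/ObservableToSLE/Lines/six_class_type_ladder.lean`): for the lattice rotation
`T = σ^{-n} = (hexRotIso n).symm` over the plane rotation `z ↦ conj(ζ^n) z` (landed transports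
`…TypeLadderRotationSAW` p121781, `…RotationGates` p122441, `…RotationSLE` p122648) we transport,
at ONE mesh, (i) endpoint approximations, (ii) the family constraint "exterior-anchored +
class-`j` windows + class-`j` fat bodies" to r7's class-`0` constraint for the rotated families
(`j = n`), (iii) the cell data (first good gates at both ends, wide link), and (iv) the carved
laws together with their curve push-forwards (probability, compact-complement and
modulus-complement masses, `f`-integrals).  No definition is introduced.
-/

noncomputable section

open scoped Topology NNReal ENNReal ComplexConjugate BoundedContinuousFunction
open Filter Set MeasureTheory Metric
open Literature.Probability.LatticeModels (HexVertex hexGraph hexCenter triZeta)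
open Literature.Probability.RandomPlanarGeometry
open Literature.Probability.RandomPlanarGeometry.SAW

namespace Summit.CriticalPhenomena.SAWScalingLimit.Theorems.ObservableToSLE.TypeLadder

open Summit.CriticalPhenomena.SAWScalingLimit.Theorems.ObservableToSLER.BridgeGate
open Summit.CriticalPhenomena.SAWScalingLimit.Theorems.ObservableToSLER.NestedGate

section OneMesh

variable (n : ℕ)

/-- `conj(ζ^n) ≠ 0`. -/
theorem conj_triZeta_pow_ne_zero : conj (triZeta ^ n) ≠ 0 :=
  left_ne_zero_of_mul_eq_one (conj_triZeta_pow_mul_self n)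

/-- The plane rotation `z ↦ conj(ζ^n) z` is an isometry. -/
theorem isometry_conj_triZeta_pow_mul : Isometry fun z : ℂ => conj (triZeta ^ n) * z :=
  Isometry.of_dist_eq fun x y => dist_unit_mul (norm_conj_triZeta_pow n) x y

/-- **(i) Endpoint approximations are rotated to endpoint approximations** of the rotated
Dobrushin domain `D.map (z ↦ conj(ζ^n) z)` (reachability along the graph isomorphism
`hexDomainGraph_adj_rot`; the endpoint limits by continuity of the rotation). -/
theorem isEmbEndpointApprox_rot (D : DobrushinDomain) (a b : ℝ → HexVertex)
    (hab : IsEmbEndpointApprox hexGraph hexCenter D a b) :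
    IsEmbEndpointApprox hexGraph hexCenter
      (D.map (Homeomorph.mulLeft₀ (conj (triZeta ^ n)) (conj_triZeta_pow_ne_zero n)))
      (fun t => (hexRotIso n).symm (a t)) (fun t => (hexRotIso n).symm (b t)) := by
  refine ⟨?_, ?_, ?_⟩
  · filter_upwards [hab.reachable] with t ht
    exact ht.map
      (⟨(hexRotIso n).symm, fun h => (hexDomainGraph_adj_rot n D.carrier t _ _).2 h⟩ :
        hexDomainGraph D.carrier t →g
          hexDomainGraph ((fun z : ℂ => conj (triZeta ^ n) * z) '' D.carrier) t)
  · have e : (fun t : ℝ => (t : ℂ) * hexCenter ((hexRotIso n).symm (a t))) =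
        fun t : ℝ => conj (triZeta ^ n) * ((t : ℂ) * hexCenter (a t)) :=
      funext fun t => rot_meshPoint n t (a t)
    rw [e]
    exact ((continuous_const_mul _).tendsto _).comp hab.tendsto_fst
  · have e : (fun t : ℝ => (t : ℂ) * hexCenter ((hexRotIso n).symm (b t))) =
        fun t : ℝ => conj (triZeta ^ n) * ((t : ℂ) * hexCenter (b t)) :=
      funext fun t => rot_meshPoint n t (b t)
    rw [e]
    exact ((continuous_const_mul _).tendsto _).comp hab.tendsto_snd

variable (Ω : Set ℂ) (δ ρ : ℝ)

/-- **(ii-a) Class-`j` windows become class-`0` windows** of the rotated family (`j = n`):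
pull the clean window back through `σ^n` (`hasCleanWindow_rot_iff`), read the class-`j` clause
there, and push it forward with `rowOf_sub_eq_rowOf_zero_rot`. -/
theorem classZeroWindows_rot (j : Fin 6) (hj : (j : ℕ) = n) (S : ℕ → Set HexVertex)
    (hS : ∀ (i : ℕ) (p q : HexVertex), HasCleanWindow Ω δ ρ (S i) p q →
      rowOf j q = rowOf j p + 1 ∧
        ∀ x : HexVertex, (δ : ℂ) * hexCenter x ∈ ball ((δ : ℂ) * hexCenter q) ρ →
          (x ∈ S i ↔ rowOf j x ≤ rowOf j p)) :
    ∀ (i : ℕ) (p q : HexVertex),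
      HasCleanWindow ((fun z : ℂ => conj (triZeta ^ n) * z) '' Ω) δ ρ
          (⇑(hexRotIso n).symm '' S i) p q →
        rowOf 0 q = rowOf 0 p + 1 ∧
          ∀ x : HexVertex, (δ : ℂ) * hexCenter x ∈ ball ((δ : ℂ) * hexCenter q) ρ →
            (x ∈ ⇑(hexRotIso n).symm '' S i ↔ rowOf 0 x ≤ rowOf 0 p) := by
  intro i p₀ q₀ hw
  obtain ⟨p, rfl⟩ := (hexRotIso n).symm.surjective p₀
  obtain ⟨q, rfl⟩ := (hexRotIso n).symm.surjective q₀
  obtain ⟨hrow, hball⟩ := hS i p q ((hasCleanWindow_rot_iff n Ω δ ρ (S i) p q).2 hw)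
  have hd := rowOf_sub_eq_rowOf_zero_rot n j q p hj
  refine ⟨by omega, fun x₀ hx₀ => ?_⟩
  obtain ⟨x, rfl⟩ := (hexRotIso n).symm.surjective x₀
  have hx : (δ : ℂ) * hexCenter x ∈ ball ((δ : ℂ) * hexCenter q) ρ := by
    rw [mem_ball] at hx₀ ⊢
    rwa [rot_meshPoint, rot_meshPoint, dist_unit_mul (norm_conj_triZeta_pow n)] at hx₀
  have hxd := rowOf_sub_eq_rowOf_zero_rot n j x p hj
  rw [(hexRotIso n).symm.injective.mem_set_image, hball x hx]
  omega

/-- **(ii-b) Class-`j` fat bodies become class-`0` fat bodies** of the rotated family: the body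
`K` is rotated to `conj(ζ^n) K` (compact, connected), its depth point
`δ c_q − (ρ/2) i ζ^j` to `δ c_{q₀} − (ρ/2) i`, and `infDist` is rotation invariant. -/
theorem fatUnderWindow_rot (j : Fin 6) (hj : (j : ℕ) = n) (S : ℕ → Set HexVertex) (c : HexVertex)
    (hS : ∀ (i : ℕ) (p q : HexVertex), HasCleanWindow Ω δ ρ (S i) p q →
      ∃ K : Set ℂ, IsCompact K ∧ IsConnected K ∧
        (δ : ℂ) * hexCenter q - ((ρ / 2 : ℝ) : ℂ) * Complex.I * triZeta ^ (j : ℕ) ∈ K ∧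
        (δ : ℂ) * hexCenter c ∈ K ∧
        ∀ v : HexVertex, Metric.infDist ((δ : ℂ) * hexCenter v) K ≤ ρ / 4 → v ∈ S i) :
    ∀ (i : ℕ) (p q : HexVertex),
      HasCleanWindow ((fun z : ℂ => conj (triZeta ^ n) * z) '' Ω) δ ρ
          (⇑(hexRotIso n).symm '' S i) p q →
        ∃ K : Set ℂ, IsCompact K ∧ IsConnected K ∧
          (δ : ℂ) * hexCenter q - ((ρ / 2 : ℝ) : ℂ) * Complex.I ∈ K ∧
          (δ : ℂ) * hexCenter ((hexRotIso n).symm c) ∈ K ∧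
          ∀ v : HexVertex, Metric.infDist ((δ : ℂ) * hexCenter v) K ≤ ρ / 4 →
            v ∈ ⇑(hexRotIso n).symm '' S i := by
  intro i p₀ q₀ hw
  obtain ⟨p, rfl⟩ := (hexRotIso n).symm.surjective p₀
  obtain ⟨q, rfl⟩ := (hexRotIso n).symm.surjective q₀
  obtain ⟨K, hK, hKc, hq, hc, hv⟩ := hS i p q ((hasCleanWindow_rot_iff n Ω δ ρ (S i) p q).2 hw)
  refine ⟨(fun z : ℂ => conj (triZeta ^ n) * z) '' K, hK.image (continuous_const_mul _),
    hKc.image _ (continuous_const_mul _).continuousOn, ?_, ?_, fun v₀ hv₀ => ?_⟩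
  · refine ⟨_, hq, ?_⟩
    show conj (triZeta ^ n) * _ = _
    rw [rot_meshPoint, hj]
    linear_combination (-(((ρ / 2 : ℝ) : ℂ) * Complex.I)) * conj_triZeta_pow_mul_self n
  · exact ⟨_, hc, (rot_meshPoint n δ c).symm⟩
  · obtain ⟨v, rfl⟩ := (hexRotIso n).symm.surjective v₀
    rw [(hexRotIso n).symm.injective.mem_set_image]
    apply hv
    rwa [rot_meshPoint, Metric.infDist_image (isometry_conj_triZeta_pow_mul n)] at hv₀

end OneMesh

section Cells

variable (n : ℕ) (Ω : Set ℂ) (δ ρ : ℝ)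

/-- **(iii) Cell data are rotated**: a realised pair of widely linked first good gates of a SAW of
`Ω_δ` becomes, for its rotated image (`exists_hexSAWRotEquiv`), a realised pair of widely linked
first good gates of the rotated families (`isFirstGoodGateN_rot`, `wideLink_rot`; the reversed
list of the image is the image of the reversed list). -/
theorem cells_rot (R : ℝ) (S T : ℕ → Set HexVertex) (a b : HexVertex) (nS nT : ℕ)
    (q q' : HexVertex)
    (h : ∃ (γ : HexDomainSAW Ω δ a b) (m : ℕ) (p : HexVertex) (m' : ℕ) (p' : HexVertex),
      IsFirstGoodGateN Ω δ ρ R S a γ.walk.support nS m p q ∧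
      IsFirstGoodGateN Ω δ ρ R T b γ.walk.support.reverse nT m' p' q' ∧
      WideLink Ω δ ρ (S nS ∪ T nT) q q') :
    ∃ (γ : HexDomainSAW ((fun z : ℂ => conj (triZeta ^ n) * z) '' Ω) δ ((hexRotIso n).symm a)
        ((hexRotIso n).symm b)) (m : ℕ) (p : HexVertex) (m' : ℕ) (p' : HexVertex),
      IsFirstGoodGateN ((fun z : ℂ => conj (triZeta ^ n) * z) '' Ω) δ ρ R
          (fun i => ⇑(hexRotIso n).symm '' S i) ((hexRotIso n).symm a) γ.walk.support nS m p
          ((hexRotIso n).symm q) ∧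
        IsFirstGoodGateN ((fun z : ℂ => conj (triZeta ^ n) * z) '' Ω) δ ρ R
          (fun i => ⇑(hexRotIso n).symm '' T i) ((hexRotIso n).symm b) γ.walk.support.reverse nT
          m' p' ((hexRotIso n).symm q') ∧
        WideLink ((fun z : ℂ => conj (triZeta ^ n) * z) '' Ω) δ ρ
          (⇑(hexRotIso n).symm '' S nS ∪ ⇑(hexRotIso n).symm '' T nT) ((hexRotIso n).symm q)
          ((hexRotIso n).symm q') := by
  obtain ⟨γ, m, p, m', p', hS, hT, hW⟩ := h
  obtain ⟨E, hE⟩ := exists_hexSAWRotEquiv n Ω δ a b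
  refine ⟨E γ, m, (hexRotIso n).symm p, m', (hexRotIso n).symm p', ?_, ?_, ?_⟩
  · rw [hE]
    exact isFirstGoodGateN_rot n Ω δ ρ R S a _ nS m p q hS
  · rw [hE, ← List.map_reverse]
    exact isFirstGoodGateN_rot n Ω δ ρ R T b _ nT m' p' q' hT
  · rw [← Set.image_union]
    exact wideLink_rot n Ω δ ρ (S nS ∪ T nT) q q' hW

end Cells

section CarvedLaw

variable {n : ℕ} {Ω : Set ℂ} {δ : ℝ} {U : Set HexVertex} {q q' : HexVertex}
  {E : HexDomainSAW Ω δ q q' ≃ HexDomainSAW ((fun z : ℂ => conj (triZeta ^ n) * z) '' Ω) δ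
    ((hexRotIso n).symm q) ((hexRotIso n).symm q')}
  (hE : ∀ γ, (E γ).walk.support = γ.walk.support.map ⇑(hexRotIso n).symm)
include hE

/-- **(iv-a) The rotated carved law is a probability measure if the carved law is.** -/
theorem isProbabilityMeasure_carvedLaw_rot
    (h : IsProbabilityMeasure (carvedLaw Ω δ U q q')) :
    IsProbabilityMeasure (carvedLaw ((fun z : ℂ => conj (triZeta ^ n) * z) '' Ω) δ
      (⇑(hexRotIso n).symm '' U) ((hexRotIso n).symm q) ((hexRotIso n).symm q')) := by
  rw [← map_carvedLaw_rot hE U]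
  exact Measure.isProbabilityMeasure_map (EmbDomainSAW.measurable_of_top _).aemeasurable

/-- **(iv-b) Curve events under the rotated carved law**: the mass of `{ξ | P ξ.curve}` under the
rotated carved law is the mass of `{ξ | P (conj(ζ^n) · ξ.curve)}` under the carved law
(`curve_rot`). -/
theorem carvedLaw_rot_apply_curve (P : CurveClass ℂ → Prop) :
    carvedLaw ((fun z : ℂ => conj (triZeta ^ n) * z) '' Ω) δ (⇑(hexRotIso n).symm '' U)
        ((hexRotIso n).symm q) ((hexRotIso n).symm q') {ξ | P ξ.curve} =
      carvedLaw Ω δ U q q'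
        {ξ | P (CurveClass.map ⟨fun z : ℂ => conj (triZeta ^ n) * z, continuous_const_mul _⟩
          ξ.curve)} := by
  rw [← map_carvedLaw_rot hE U, Measure.map_apply (EmbDomainSAW.measurable_of_top _)
    MeasurableSpace.measurableSet_top]
  congr 1
  ext ξ
  simp only [Set.mem_preimage, Set.mem_setOf_eq, curve_rot hE]

/-- **(iv-c) Curve observables under the rotated carved law**:
`∫ g(ξ.curve) d(rotated carved law) = ∫ g(conj(ζ^n) · ξ.curve) d(carved law)`. -/
theorem integral_carvedLaw_rot (g : CurveClass ℂ → ℝ) :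
    ∫ ξ, g ξ.curve ∂(carvedLaw ((fun z : ℂ => conj (triZeta ^ n) * z) '' Ω) δ
        (⇑(hexRotIso n).symm '' U) ((hexRotIso n).symm q) ((hexRotIso n).symm q')) =
      ∫ ξ, g (CurveClass.map ⟨fun z : ℂ => conj (triZeta ^ n) * z, continuous_const_mul _⟩
        ξ.curve) ∂(carvedLaw Ω δ U q q') := by
  rw [← map_carvedLaw_rot hE U]
  have e : (carvedLaw Ω δ U q q').map E =
      (carvedLaw Ω δ U q q').map
        (⟨E, EmbDomainSAW.measurable_of_top _, EmbDomainSAW.measurable_of_top _⟩ :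
          HexDomainSAW Ω δ q q' ≃ᵐ
            HexDomainSAW ((fun z : ℂ => conj (triZeta ^ n) * z) '' Ω) δ ((hexRotIso n).symm q)
              ((hexRotIso n).symm q')) := rfl
  rw [e, integral_map_equiv]
  refine integral_congr_ae (Filter.Eventually.of_forall fun ξ => ?_)
  show g (E ξ).curve = _
  rw [curve_rot hE]

end CarvedLaw

/-- HELPER STUB H4 (S2 assembly, part A) — **cell data are rotated**: a realised pair of widely
linked first good gates of a SAW of `Ω_δ` becomes, for its image under the lattice rotation
`σ^{-n}`, a realised pair of widely linked first good gates of the rotated families in the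
rotated domain `conj(ζ^n) Ω`. -/
theorem stub_rotationCells :
    ∀ (n : ℕ) (Ω : Set ℂ) (δ ρ R : ℝ) (S T : ℕ → Set HexVertex) (a b : HexVertex) (nS nT : ℕ)
      (q q' : HexVertex),
      (∃ (γ : HexDomainSAW Ω δ a b) (m : ℕ) (p : HexVertex) (m' : ℕ) (p' : HexVertex),
        IsFirstGoodGateN Ω δ ρ R S a γ.walk.support nS m p q ∧
        IsFirstGoodGateN Ω δ ρ R T b γ.walk.support.reverse nT m' p' q' ∧
        WideLink Ω δ ρ (S nS ∪ T nT) q q') →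
      ∃ (γ : HexDomainSAW ((fun z : ℂ => (starRingEnd ℂ) (triZeta ^ n) * z) '' Ω) δ
          ((hexRotIso n).symm a) ((hexRotIso n).symm b)) (m : ℕ) (p : HexVertex) (m' : ℕ)
          (p' : HexVertex),
        IsFirstGoodGateN ((fun z : ℂ => (starRingEnd ℂ) (triZeta ^ n) * z) '' Ω) δ ρ R
            (fun i => ⇑(hexRotIso n).symm '' S i) ((hexRotIso n).symm a) γ.walk.support nS m p
            ((hexRotIso n).symm q) ∧
          IsFirstGoodGateN ((fun z : ℂ => (starRingEnd ℂ) (triZeta ^ n) * z) '' Ω) δ ρ R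
            (fun i => ⇑(hexRotIso n).symm '' T i) ((hexRotIso n).symm b) γ.walk.support.reverse nT
            m' p' ((hexRotIso n).symm q') ∧
          WideLink ((fun z : ℂ => (starRingEnd ℂ) (triZeta ^ n) * z) '' Ω) δ ρ
            (⇑(hexRotIso n).symm '' S nS ∪ ⇑(hexRotIso n).symm '' T nT) ((hexRotIso n).symm q)
            ((hexRotIso n).symm q') :=
  fun n Ω δ ρ R S T a b nS nT q q' h => cells_rot n Ω δ ρ R S T a b nS nT q q' h

end Summit.CriticalPhenomena.SAWScalingLimit.Theorems.ObservableToSLE.TypeLadder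

end
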